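import Summits.Ventures.CertifiedManyBodySolver.Theorems.TcThermcert1VertexComposition
import Summits.Ventures.CertifiedManyBodySolver.Theses.TcThermcert1
import HarnessLib
import HarnessLib.Audit

/-!
# Line `vertex` (v2.2, registered at birth on stmt-Ventures-26382) for crux K2 `ThermalStiffnessCeilingBoxb10_le_9o71` of route «hubbard-tc-thermcert-1» (`TcThermcert1`, packet v4, RULINGS R121/R123)
# — BOX TRANSPORT WITHOUT LIPSCHITZ CONSTANTS: the (U, μ₀)-CELL CORNER RULE for frozen-multiplier thermal certificates

Cell `pub/hubbard-tc` (MO-S3), D-0154 (1) block (D); CRUX-PLAN by hub-tc-therm-plan-2 g0 (2026-08-28).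
HONEST FRAMING: a one-sided CEILING chain on the thermal flux stiffness under hypotheses; nothing about the Hubbard model is
proved in this file (the three `stub_*` theorems are `sorry`); KT ceilings never assert superconductivity; NO lower bound on
`T_c` is claimed; no summit statement is proved by this seat.

THE CRUX (fixed, route decl, R121 (2)): `K1 → ∀ U, 79/10 ≤ U → U ≤ 147/10 → ObsThermalStiffnessSeqCeilingAtBeta 0 U (7/8) 10 (9/71)`
— at `β·t = 10`, `(n, t′) = (7/8, 0)`, on the WHOLE box `U/t ∈ [7.9, 14.7]`, every thermal uniform flux-stiffness constant is
`≤ 9/71` (`(π/4)·(9/71) < 1/10`). The K1 antecedent is decorative (hub-tc-therm-crit-2 (b)); this line proves the consequent outright.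

THE LINE («vertex»). The opener's birth skeleton (hub-tc-therm-plan-1, `K2_birth.lean`) reads the box leaf off three stubs:
the general local-trial-generator thermal hook (S1), box admissibility of torus limits as THERMAL ROW STATES (S2), and a
per-`U` family of trial-generator certificates `≤ 9/71` (their STUB 3: `∀ U ∈ box, ∃ a, ∀ μ₀ ∈ band, …`). An uncountable per-`U`
family is not a finite object; `∃ a ∀ μ₀ ∈ band` over-asks (hub-tc-therm-crit-2 FINDING #2 (3): one generator against a 16·t-wide band of
mostly phantom-feasible `μ₀`); and the transport named in R121 («Duhamel–Lipschitz ∝ β on a certified U-grid») is volume-uniform only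
with clustering at `β·t = 10` (none in print within a factor 650 of the needed radius: KGKRE2014 Thm 4, FrohlichUeltschi2015 Thm 3.2).
THIS LINE REPLACES STUB 3 BY A FINITE, `(U, μ₀)`-FREE OBJECT and PROVES S2, transferring the tree's `T = 0` corner-certificate rule
(`HubbardTTPrimeWindowCertificateConvexComb`: corner certificates of a `(t′, U)` box sharing the coupling-carrying rows combine
to every point of the box; abstractly `Transport.BoxCertificate.le_affine_sub_sum_abs_of_forall_boxVertices`) to `T > 0`:
* every row of `IsThermalRowState β t′ U n μ₀` — GC stationarity `ω([K, Â]) = 0`, the `(s,q)`-linearised energy–entropy balance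
  `β·ω(Âᴴ[K,Â]) − s·ω(ÂᴴÂ) + q·ω(ÂÂᴴ) ≥ 0` (`e^{s−1} ≤ q`), the canonical Bogoliubov rows — and the objective `W_a(U) = trialWord 0 U r a`
  are expectation values of local words AFFINE IN THE PAIR `(U, μ₀)` (`K = H₀ + U·D − μ₀·N` enters each word once:
  `gcLocalHamiltonianTT'_eq`, `hubbardTTPrimeFermionInteraction_add/_smul`, bilinearity of `commDensity`); ad_K-degree ≤ 1
  throughout — no KMS moment cuts of order ≥ 2 occur in this row class, so nothing needs lifting (hub-tc-therm-idea-3's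
  orthant lift / a Bernstein envelope enter only if degree-k moment rows are added later);
* hence, for a FROZEN multiplier datum `d` (finitely many rows with fixed multipliers, `y ≥ 0` on inequality rows), the
  Lagrangian `L_d(U, μ₀; ω) = Re ω(W_a(U)) + Σ y·Re ω(row(U, μ₀))` is, for each state `ω`, an AFFINE function of `(U, μ₀)`
  (stub S3, provable today), dominates `Re ω(W_a(U))` on thermal row states at `(U, μ₀)` (bookkeeping, proved here), and on a
  CELL `[U₁,U₂] × [μ₁,μ₂]` is bounded by its maximum over the FOUR CORNERS (two-step edge interpolation, proved here);
* so FOUR parameter-free certificate facts per cell — `L_d ≤ 9/71` at each corner, for every translation-invariant state of density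
  `7/8` (a parameter-free superset of all row states of the cell) — certify the leaf word on the whole cell, and a FINITE rational CELL
  COVER (stub S4, THE crux content) of the BANDED SUPPORTING SET `{(U, μ₀) : U ∈ box, μ₀ ∈ band(U), μ₀ supporting for p(10;1,0,U;·) at 7/8}`
  certifies the box. Zero Lipschitz constants, zero clustering input; the price of transport is the slack of a frozen dual between
  corners, paid by refining the cover; any certified enclosure of the supporting set prunes cells WITHOUT re-typing.
* S2 (row admissibility) is a THEOREM, not a stub: `isThermalRowState_of_supportingMu` + `exists_supportingMu_mem_band` (the opener's §1′,
  byte-copied; the `U = 8` original is hub-tc-therm-crit-2's `Stub2Uniform.lean` 6a21b4749dbe9595): the supporting `μ₀` of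
  `exists_chemicalPotential_mem_band` serves every torus limit through the tree's `…_of_sectorGibbs_of_localDKMS` row theorems.
STUBS (3): S1 `stub_trialGeneratorHook` (L; verbatim the opener's, shared with K1's line `trialgen_b10`) · S3 `stub_lagr_affine`
(M; provable today) · S4 `stub_vertexCover` (XL; load-bearing).
COMPOSITION (sorry-free): S3 + S4 ⇒ the opener's STUB 2 statement `TrialGeneratorCertificateBoxB10` (v2 = crit-2's STUB 3″ shape on the
box: generator per `(U, μ₀)`, only at banded supporting `μ₀`; `certificateBox_of_vertexCover`) ⇒ with S1 and the proved admissibility the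
box leaf (`box_of_stubs`, the opener's, verbatim) ⇒ K2 (`ThermalStiffnessCeilingBoxb10_le_9o71_of`).
Objects `trialWord`, `IsTrialGenerator`, `InMuBand`, `IsThermalRowState`, `TrialGeneratorHook`, `IsSupportingMu`, `TrialGeneratorCertificateBoxB10`,
`isThermalRowState_of_supportingMu`, `exists_supportingMu_mem_band`, `box_of_stubs` are BYTE-COPIES of hub-tc-therm-plan-1's
`K2_birth.lean` v2 (sha16 17ea93d255f5018b) §0–§1′, §3, to be imported from `Cruxes/ThermalStiffnessCeilingU8b10_le_1o8/Lines/trialgen_b10.lean` /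
`Cruxes/ThermalStiffnessCeilingBoxb10_le_9o71/Lines/birth.lean` once those files are in the tree (then §1 of this file is deleted and the
names resolve to the opener's).
References: DLS1978 §2 eqs. (22′), (27), (28); FawziFawziScalet2024 Thm. 3.1; ArakiMoriya2003 Thm. 12.11; Simon1993 Thm. II.15.1;
BratteliRobinsonII1997 Thm. 6.2.4; Han2020 §2–3; WangEtAl2024 §III (frozen-dual / corner certificates); KGKRE2014 Thm 4 (why not
Duhamel–Lipschitz).
-/

/-! ## v4 (staged by hubbard-tc-p1 g28 under lead RULINGS R140 ∕ R143; NOT registered by this seat — hub-tc-therm-crit-2 ∕ the K2 lead registers per R143)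
v4 = the registered v2.2 (sha16 135a6fd895490092) with EVERY landed piece imported from the tree instead of declared here:
* §1a/§1b objects and statements (`trialWord`, `IsTrialGenerator`, `InMuBand`, `IsThermalRowState`, `TrialGeneratorHook`, `IsSupportingMu`)
  ← `Theorems/TcThermcert1Defs.lean` (hubbard-thermal-p4, p614173); the proved row admissibility `isThermalRowState_of_supportingMu` ∕
  `exists_supportingMu_mem_band` ← `Theorems/TcThermcert1TrialGeneratorSockets.lean` (p615465);
* §2 objects (`stWord`, `eebWord`, `bogWord`, `StRow`, `EebRow`, `BogRow`, `CertDatum`, `.lagr`, `.RectCert`, `.LagrAffine`), §3 statements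
  (`LagrAffineAll`, `VertexCoverBoxB10`) and the opener's `TrialGeneratorCertificateBoxB10` ← `Theorems/TcThermcert1VertexDefs.lean` (hubbard-tc-p1 g28, p615964);
* STUB S1 `stub_trialGeneratorHook` ← `Theorems/TcThermcert1VertexStubTrialGeneratorHook.lean` (p614740, `Vertex.stub_trialGeneratorHook`);
* STUB S3 `stub_lagr_affine` ← `Theorems/TcThermcert1VertexLagrAffine.lean` (p616377, `Vertex.stub_lagr_affine`; proof = plan-2's kit 798cc13f9ea7b5b6 §6–§7);
* §5 composition (`CertDatum.re_trialWord_le_lagr`, `le_of_affine_of_endpoints`, `CertDatum.lagr_le_of_rectCert`, `certificateBox_of_vertexCover`,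
  `box_of_stubs`, `ThermalStiffnessCeilingBoxb10_le_9o71_of`, `…_of_vertexCover`) ← `Theorems/TcThermcert1VertexComposition.lean` (hubbard-tc-p1 g28);
* the ONE remaining `sorry` is STUB S4 `stub_vertexCover : VertexCoverBoxB10` (the crux content, registered name + signature unchanged), and the
  skeleton theorem is `ThermalStiffnessCeilingBoxb10_le_9o71_holds_of_stubs := Vertex.ThermalStiffnessCeilingBoxb10_le_9o71_of_vertexCover stub_vertexCover`. -/

noncomputable section

namespace Summit.Ventures.CertifiedManyBodySolver.Cruxes.ThermalStiffnessCeilingBoxb10_le_9o71.Vertex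

open Summit.Ventures.CertifiedManyBodySolver.Observables
open Summit.Ventures.CertifiedManyBodySolver.Theses.TcThermcert1
open Summit.Ventures.CertifiedManyBodySolver.Theorems.TcThermcert1
open Summit.Ventures.CertifiedManyBodySolver.Theorems.TcThermcert1.Vertex

/-! ## §4 Registered stubs — v4: S1 and S3 are LANDED tree theorems (imported); the only `sorry` of this file is S4 -/

/-- STUB S4 (XL — THE CRUX CONTENT of K2 in finite form): a finite rational cell cover of the banded supporting set over `[7.9, 14.7]`
with four frozen-dual CORNER certificates `≤ 9/71` per cell (producers: one trial generator `a` + one multiplier vector per cell, solved as a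
`(U, μ₀)`-free SDP/relative-entropy dual at each corner; refine where the frozen dual's slack between corners exceeds the margin; prune cells
off any certified enclosure of the supporting set). Why it might fail: (i) POINTWISE — the `W_a` class may not reach `9/71` at some `(U, μ₀)`
of the set at affordable range `r` (mod-2's 12-site Krylov capture 0–0.9 %; crit-1 F4's 51 %-of-κ/2 requirement); (ii) TRANSPORT — frozen
duals may lose margin fast in `U` at β·t = 10 (EEB rows carry the factor β = 10), forcing many cells (each = 4 certificates); (iii) PHANTOM
FEASIBILITY off the supporting set inside the band until an enclosure is certified. [cite: WangEtAl2024, §III] [cite: Han2020, §2]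
[cite: ScalapinoWhiteZhang1993, §II] -/
theorem stub_vertexCover : VertexCoverBoxB10 := by
  sorry

/-! ## §5 Composition (sorry-free; the lemmas are the tree's `Theorems/TcThermcert1VertexComposition.lean`)
v4.2 (hub-tc-therm-crit-2 g1, registration plumbing): the hypothesis-form re-export `…_of : TrialGeneratorHook → LagrAffineAll →
VertexCoverBoxB10 → K2` of v4 is OMITTED here (it is the tree theorem `Vertex.ThermalStiffnessCeilingBoxb10_le_9o71_of`, p618478, use it by
that name): `ledger skeleton check` requires every crux-concluding theorem of a line file to have hypotheses = declared stubs, and S1/S3 are no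
longer stubs of this file. Bytes otherwise = v4 58a9c11d33b40c21. -/

/-- THE SKELETON THEOREM: the one registered open stub S4 gives the crux BY NAME — the route decl
`Summit.Ventures.CertifiedManyBodySolver.Theses.TcThermcert1.ThermalStiffnessCeilingBoxb10_le_9o71` (item stmt-Ventures-26382, route-Ventures-TcThermcert1);
S1 (`Vertex.stub_trialGeneratorHook`, p614740) and S3 (`Vertex.stub_lagr_affine`, p616377) are fed from the tree inside `…_of_vertexCover`. -/
theorem ThermalStiffnessCeilingBoxb10_le_9o71_holds_of_stubs : ThermalStiffnessCeilingBoxb10_le_9o71 :=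
  ThermalStiffnessCeilingBoxb10_le_9o71_of_vertexCover stub_vertexCover

end Summit.Ventures.CertifiedManyBodySolver.Cruxes.ThermalStiffnessCeilingBoxb10_le_9o71.Vertex

end
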